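import Literature.Probability.RandomPlanarGeometry.ConformalRestrictionHolds
import Literature.Probability.RandomPlanarGeometry.ConformalRestrictionLocal
import Literature.Probability.RandomPlanarGeometry.HullRestrictionSLEHolds
import Literature.Probability.RandomPlanarGeometry.CritPercSLESimplePathHolds
import Literature.Probability.RandomPlanarGeometry.SLEExistenceNeEightHolds
import Summits.CriticalPhenomena.SAWScalingLimit.Theses.SAWPoincareChain
import Summits.CriticalPhenomena.SAWScalingLimit.Theorems.SAWPoincareChainDiscRestrictionIsSLETransport
import HarnessLib

/-!
# `DiscRestrictionIsSLE`: a restriction law on chordal curves of the unit disc is chordal SLE_{8/3}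

Closes item `stmt-CriticalPhenomena-7559` (`DiscRestrictionIsSLE`, support) of route
`SAWPoincareChain` of `CriticalPhenomena/SAWScalingLimit`:
`Summit.CriticalPhenomena.SAWScalingLimit.Theorems.discRestrictionIsSLE_proof`.

The item is Lawler–Schramm–Werner's p. 5 result 2 (*Conformal restriction: the chordal case*,
J. Amer. Math. Soc. 16 (2003): "the only restriction measure supported on simple curves is
`P_{5/8}`, the law of chordal SLE_{8/3}") in ONE reference domain `(𝔻; 1, -1)`: a probability
law `μ` on curve classes carried by curves of the closed disc from `1` to `-1`, invariant under
the automorphisms of `(𝔻; 1, -1)`, with the hull-restriction-with-transport property over the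
hull subdomains of the disc and carried by simple curves touching the circle only at `±1`, is
`IsSLELaw (8/3) DobrushinDomain.unitDisc μ`.

Proof. The sibling file `SAWPoincareChainDiscRestrictionIsSLETransport` transports `μ` to the
chordal family `D ↦ (G_D)_* μ` (Riemann mapping, Carathéodory, Tietze) and proves it chordal,
conformally covariant and carried by simple curves. Here:

* `DiscRestriction.isHullRestriction_transport` — the transported family satisfies two-sided
  restriction over hull subdomains: a hull subdomain `D' ⊆ D` is pulled back along the
  homeomorphism `Θ_D = G_D⁻¹` of `closure D` onto the closed disc to a hull subdomain
  `U = Θ_D(D')` of the disc (`MarkedDomain.image`), where the hypothesis on `μ` applies to the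
  conformal map `Θ_D ∘ g_{D'} : 𝔻 → U` and its continuous extension `Θ̃_D ∘ G_{D'}`;
* `isSLELaw_of_isHullRestriction` — the tree's PROVED uniqueness half of [LSW] p. 5 result 2
  (`LawlerSchrammWerner2003_unique_holds`) against the family of SLE_{8/3} laws
  (`exists_isSLECurve_eightThirds`, `ChordalFamily.spec_of_isSLELaw_eightThirds`,
  `IsSLELaw.hullRestriction_eightThirds_holds`, `ae_isSimpleTrace_sleTrace_of_le_four_holds`):
  such a family is the SLE_{8/3} law in every Dobrushin domain;
* `discRestrictionIsSLE_proof` — and the transported law in the disc is `μ` itself by the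
  invariance hypothesis (`g_𝔻` is an automorphism of `(𝔻; 1, -1)`).

Unconditional: no named-fact hypothesis. Sources: [LSW] p. 5 result 2, Remark 3.8;
Ch. Pommerenke, *Boundary Behaviour of Conformal Maps* (1992), Thm. 2.6. No new definitions.
-/

noncomputable section

open Set Filter Topology MeasureTheory Metric
open Literature.Probability.RandomPlanarGeometry

namespace Summit.CriticalPhenomena.SAWScalingLimit.Theorems.DiscRestriction


/-! ### Restriction over hull subdomains of the transported family -/

section Restriction

variable {μ : Measure (CurveClass ℂ)}
  {g : ∀ D : DobrushinDomain, ConformalEquiv (DobrushinDomain.unitDisc).carrier D.carrier}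
  {G : DobrushinDomain → C(ℂ, ℂ)} {Θ : DobrushinDomain → ℂ → ℂ}

/-- **Restriction over hull subdomains of the transported family.** If `μ` (carried by the closed
disc) has the hull-restriction-with-transport property over the hull subdomains of `(𝔻; 1, -1)`,
then `D ↦ (G D)_* μ` satisfies two-sided restriction over hull subdomains: a hull subdomain
`D'` of `D` pulls back along the homeomorphism `Θ_D = G_D⁻¹ : closure D → closed disc` to the
hull subdomain `U = Θ_D(D')` of the disc (`MarkedDomain.image`), `Θ_D ∘ g_{D'} : 𝔻 → U` is
conformal with boundary values `±1 ↦ ±1` and continuous extension `Θ̃_D ∘ G_{D'}`, and the three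
terms of the restriction identity for `U` are the three terms for `(D, D')` (the curves live in
the closed disc, where `G_D ∘ Θ̃_D ∘ G_{D'} = G_{D'}` and `G_D(trace) ⊆ cl D' ⟺ trace ⊆ cl U`).
[folklore] -/
theorem isHullRestriction_transport
    (hμ : ∀ᵐ γ ∂μ, γ.range ⊆ closure (DobrushinDomain.unitDisc).carrier)
    (hRes : ∀ U : DobrushinDomain, MarkedDomain.IsHullSubdomain DobrushinDomain.unitDisc U →
      ∀ (k : ConformalEquiv (DobrushinDomain.unitDisc).carrier U.carrier) (Φ : C(ℂ, ℂ)),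
        k.HasBoundaryValue (DobrushinDomain.unitDisc.pt 0) (DobrushinDomain.unitDisc.pt 0) →
        k.HasBoundaryValue (DobrushinDomain.unitDisc.pt 1) (DobrushinDomain.unitDisc.pt 1) →
        EqOn Φ k (DobrushinDomain.unitDisc).carrier →
        ∀ T : Set (CurveClass ℂ), MeasurableSet T →
          μ.map (CurveClass.map Φ) T * μ (CurveClass.rangeSubset (closure U.carrier)) =
            μ (T ∩ CurveClass.rangeSubset (closure U.carrier)))
    (hGg : ∀ D, EqOn (G D) (g D) (DobrushinDomain.unitDisc).carrier)
    (hb : ∀ D (i : Fin 2), (g D).HasBoundaryValue (DobrushinDomain.unitDisc.pt i) (D.pt i))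
    (hG : ∀ D (i : Fin 2), G D (DobrushinDomain.unitDisc.pt i) = D.pt i)
    (hΘc : ∀ D : DobrushinDomain, ContinuousOn (Θ D) (closure D.carrier))
    (hΘG : ∀ D, ∀ ζ ∈ closure (DobrushinDomain.unitDisc).carrier, Θ D (G D ζ) = ζ)
    (hGΘ : ∀ D : DobrushinDomain, ∀ w ∈ closure D.carrier, G D (Θ D w) = w)
    (hΘsymm : ∀ D : DobrushinDomain, EqOn (Θ D) (g D).symm D.carrier)
    (hΘD : ∀ D : DobrushinDomain, MapsTo (Θ D) D.carrier (DobrushinDomain.unitDisc).carrier) :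
    ChordalFamily.IsHullRestriction (fun D ↦ μ.map (CurveClass.map (G D))) := by
  intro D D' hDD' T hT
  change μ.map (CurveClass.map (G D')) T *
      μ.map (CurveClass.map (G D)) (CurveClass.rangeSubset (closure D'.carrier)) =
    μ.map (CurveClass.map (G D)) (T ∩ CurveClass.rangeSubset (closure D'.carrier))
  -- generalities on `D' ⊆ D` and `Θ_D`
  have hsub : D'.carrier ⊆ D.carrier := hDD'.carrier_subset
  have hcl : closure D'.carrier ⊆ closure D.carrier := closure_mono hsub
  have hΘinj : InjOn (Θ D) (closure D.carrier) := fun w₁ hw₁ w₂ hw₂ h ↦ by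
    rw [← hGΘ D w₁ hw₁, ← hGΘ D w₂ hw₂, h]
  have hΘc' : ContinuousOn (Θ D) (closure D'.carrier) := (hΘc D).mono hcl
  have hΘi' : InjOn (Θ D) (closure D'.carrier) := hΘinj.mono hcl
  have hpt : ∀ i : Fin 2, D'.pt i = D.pt i := by
    intro i
    fin_cases i
    exacts [hDD'.pt_zero_eq, hDD'.pt_one_eq]
  have hΘpt : ∀ i : Fin 2, Θ D (D.pt i) = DobrushinDomain.unitDisc.pt i := fun i ↦ by
    rw [← hG D i]
    exact hΘG D _ (frontier_subset_closure (DobrushinDomain.unitDisc.pt_mem_frontier i))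
  -- the pulled-back hull subdomain `U = Θ_D (D')` of the disc
  set U : DobrushinDomain := MarkedDomain.image D' (Θ D) hΘc' hΘi' with hU
  have hUpt : ∀ i, U.pt i = Θ D (D'.pt i) := fun i ↦ rfl
  have hUcl : closure U.carrier = Θ D '' closure D'.carrier :=
    MarkedDomain.closure_carrier_image _ _ _ _
  have hdiff_sub : (DobrushinDomain.unitDisc).carrier \ U.carrier ⊆
      Θ D '' (D.carrier \ D'.carrier) := by
    rintro z ⟨hz, hzU⟩
    have hw : G D z ∈ D.carrier := by rw [hGg D hz]; exact (g D).mapsTo hz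
    have hΘw : Θ D (G D z) = z := hΘG D z (subset_closure hz)
    exact ⟨G D z, ⟨hw, fun hw' ↦ hzU ⟨G D z, hw', hΘw⟩⟩, hΘw⟩
  have hcl_diff : closure ((DobrushinDomain.unitDisc).carrier \ U.carrier) ⊆
      Θ D '' closure (D.carrier \ D'.carrier) := by
    refine (closure_mono hdiff_sub).trans (subset_of_eq ?_)
    exact closure_image_of_isBounded (D.isBounded.subset sdiff_subset)
      ((hΘc D).mono (closure_mono sdiff_subset))
  have hnot : ∀ i : Fin 2, D.pt i ∉ closure (D.carrier \ D'.carrier) →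
      DobrushinDomain.unitDisc.pt i ∉
        closure ((DobrushinDomain.unitDisc).carrier \ U.carrier) := by
    intro i hi hmem
    obtain ⟨y, hy, hyx⟩ := hcl_diff hmem
    have hy' : y ∈ closure D.carrier := closure_mono sdiff_subset hy
    have hyD : y = D.pt i :=
      hΘinj hy' (frontier_subset_closure (D.pt_mem_frontier i)) (by rw [hyx, hΘpt i])
    exact hi (hyD ▸ hy)
  have hUhull : MarkedDomain.IsHullSubdomain DobrushinDomain.unitDisc U := by
    refine ⟨?_, ?_, ?_, hnot 0 hDD'.pt_zero_notMem, hnot 1 hDD'.pt_one_notMem⟩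
    · rintro _ ⟨w, hw, rfl⟩
      exact hΘD D (hsub hw)
    · rw [hUpt, hpt, hΘpt]
    · rw [hUpt, hpt, hΘpt]
  -- the conformal map `Θ_D ∘ g_{D'} : 𝔻 → U` and its continuous extension `Θ̃_D ∘ G_{D'}`
  have hΘdiff : DifferentiableOn ℂ (Θ D) D'.carrier :=
    ((g D).symm.differentiableOn_coe.mono hsub).congr fun w hw ↦ hΘsymm D (hsub hw)
  set r : ConformalEquiv D'.carrier U.carrier :=
    ConformalEquiv.ofInjOn (Θ D) D'.isOpen hΘdiff (hΘi'.mono subset_closure) rfl with hr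
  set gU : ConformalEquiv (DobrushinDomain.unitDisc).carrier U.carrier := (g D').trans r with hgU
  obtain ⟨Θt, hΘt⟩ := exists_continuousMap_eqOn isClosed_closure (hΘc D)
  set ΦU : C(ℂ, ℂ) := Θt.comp (G D') with hΦU
  have hΦU_eq : EqOn ΦU gU (DobrushinDomain.unitDisc).carrier := by
    intro z hz
    have hgz : g D' z ∈ D'.carrier := (g D').mapsTo hz
    change Θt (G D' z) = r (g D' z)
    rw [hGg D' hz, hΘt (hcl (subset_closure hgz)), ConformalEquiv.ofInjOn_apply]
  have hbU : ∀ i : Fin 2,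
      gU.HasBoundaryValue (DobrushinDomain.unitDisc.pt i) (DobrushinDomain.unitDisc.pt i) := by
    intro i
    have t1 := tendsto_nhdsWithin_of_hasBoundaryValue (g D') (hb D' i)
    have hx : D'.pt i ∈ closure D.carrier :=
      hcl (frontier_subset_closure (D'.pt_mem_frontier i))
    have t2 : Tendsto (Θ D) (𝓝[D'.carrier] (D'.pt i)) (𝓝 (Θ D (D'.pt i))) :=
      ((hΘc D) _ hx).mono_left (nhdsWithin_mono _ (subset_closure.trans hcl))
    have hval : Θ D (D'.pt i) = DobrushinDomain.unitDisc.pt i := by rw [hpt i, hΘpt i]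
    rw [hval] at t2
    exact t2.comp t1
  -- the restriction identity for `U`, applied to `S = (G_D)_*⁻¹ T`
  have hS : MeasurableSet (CurveClass.map (G D) ⁻¹' T) := CurveClass.measurable_map _ hT
  have key := hRes U hUhull gU ΦU (hbU 0) (hbU 1) hΦU_eq _ hS
  have hmU : MeasurableSet (CurveClass.rangeSubset (closure U.carrier)) :=
    CurveClass.measurableSet_rangeSubset isClosed_closure
  have hmD' : MeasurableSet (CurveClass.rangeSubset (closure D'.carrier)) :=
    CurveClass.measurableSet_rangeSubset isClosed_closure
  rw [Measure.map_apply (CurveClass.measurable_map _) hS] at key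
  rw [Measure.map_apply (CurveClass.measurable_map _) hT,
    Measure.map_apply (CurveClass.measurable_map _) hmD',
    Measure.map_apply (CurveClass.measurable_map _) (hT.inter hmD')]
  -- `G_D ∘ Θ̃_D ∘ G_{D'} = G_{D'}` on the closed disc
  have hcompEq : EqOn ((G D).comp ΦU) (G D') (closure (DobrushinDomain.unitDisc).carrier) := by
    intro z hz
    have h1 : G D' z ∈ closure D'.carrier := mapsTo_closure (hGg D') hz
    change G D (Θt (G D' z)) = G D' z
    rw [hΘt (hcl h1), hGΘ D _ (hcl h1)]
  have hA : (CurveClass.map ΦU ⁻¹' (CurveClass.map (G D) ⁻¹' T) : Set (CurveClass ℂ)) =ᵐ[μ]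
      (CurveClass.map (G D') ⁻¹' T : Set (CurveClass ℂ)) := by
    filter_upwards [hμ] with γ hγ
    refine propext ?_
    change CurveClass.map (G D) (CurveClass.map ΦU γ) ∈ T ↔ CurveClass.map (G D') γ ∈ T
    rw [← curveClassMap_comp, curveClassMap_congr (hcompEq.mono hγ)]
  -- `G_D (trace) ⊆ cl D' ⟺ trace ⊆ cl U` for traces in the closed disc
  have hB : (CurveClass.map (G D) ⁻¹' CurveClass.rangeSubset (closure D'.carrier) :
      Set (CurveClass ℂ)) =ᵐ[μ]
      (CurveClass.rangeSubset (closure U.carrier) : Set (CurveClass ℂ)) := by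
    filter_upwards [hμ] with γ hγ
    refine propext ?_
    change CurveClass.map (G D) γ ∈ CurveClass.rangeSubset (closure D'.carrier) ↔
      γ ∈ CurveClass.rangeSubset (closure U.carrier)
    rw [CurveClass.mem_rangeSubset, CurveClass.mem_rangeSubset, CurveClass.range_map, hUcl,
      image_subset_iff]
    constructor
    · intro h x hx
      exact ⟨G D x, h hx, hΘG D x (hγ hx)⟩
    · intro h x hx
      obtain ⟨y, hy, hyx⟩ := h hx
      change G D x ∈ closure D'.carrier
      rw [← hyx, hGΘ D y (hcl hy)]
      exact hy
  rw [measure_congr hA] at key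
  rw [measure_congr hB, preimage_inter, measure_congr ((EventuallyEq.refl _ _).inter hB)]
  exact key

end Restriction

end Summit.CriticalPhenomena.SAWScalingLimit.Theorems.DiscRestriction

/-! ### The identification with SLE_{8/3} -/

namespace Summit.CriticalPhenomena.SAWScalingLimit.Theorems

open scoped NNReal
open DiscRestriction

/-- **[LSW] p. 5 result 2 with restriction over HULL subdomains only** (the paper's hypothesis):
a chordal, conformally covariant chordal family with two-sided restriction over hull subdomains,
carried by simple curves meeting the boundary only at the marked points, is the chordal SLE_{8/3}
law in every Dobrushin domain — by the proved uniqueness half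
`LawlerSchrammWerner2003_unique_holds`
against the family of SLE_{8/3} laws (`exists_isSLECurve_eightThirds`,
`ChordalFamily.spec_of_isSLELaw_eightThirds` with `IsSLELaw.hullRestriction_eightThirds_holds` and
`ae_isSimpleTrace_sleTrace_of_le_four_holds`).
[cite: LawlerSchrammWerner2003Restriction, p. 5 result 2] -/
theorem isSLELaw_of_isHullRestriction {P : ChordalFamily} (hP : P.IsChordal)
    (hcov : P.IsConformallyCovariant) (hres : P.IsHullRestriction)
    (hS : P.IsCarriedBySimpleCurves) (D : DobrushinDomain) :
    IsSLELaw ((8 : ℝ≥0) / 3) D (P D) := by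
  choose Γ hΓ using exists_isSLECurve_eightThirds
  have hQ : ∀ D : DobrushinDomain,
      IsSLELaw ((8 : ℝ≥0) / 3) D
        ((fun D' ↦ Literature.Probability.Process.preWienerMeasure.map (Γ D')) D) :=
    fun D ↦ (hΓ D).isSLELaw_map
  obtain ⟨hQc, hQcov, hQres, hQs⟩ := ChordalFamily.spec_of_isSLELaw_eightThirds hQ
    IsSLELaw.hullRestriction_eightThirds_holds ae_isSimpleTrace_sleTrace_of_le_four_holds
  rw [LawlerSchrammWerner2003_unique_holds P _ hP hcov hres hS hQc hQcov hQres hQs D]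
  exact hQ D

/-- **`DiscRestrictionIsSLE` (item stmt-CriticalPhenomena-7559 of route SAWPoincareChain).** A
probability law on curve classes carried by curves of the closed unit disc from `1` to `-1`,
invariant under the automorphisms of `(𝔻; 1, -1)` pushed along continuous extensions, with the
hull-restriction-with-transport property over the hull subdomains of the disc, and carried by
simple curves touching the circle only at `±1`, is the chordal SLE_{8/3} law of `(𝔻; 1, -1)`.
Proof: transport `μ` to the chordal family `D ↦ (G_D)_* μ` (`exists_transportData`), which is
chordal, conformally covariant, hull-restriction and simple (`isChordal_transport`,
`isConformallyCovariant_transport`, `isHullRestriction_transport`,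
`isCarriedBySimpleCurves_transport`), hence SLE_{8/3} in every domain
(`isSLELaw_of_isHullRestriction`, i.e. Lawler–Schramm–Werner 2003, p. 5 result 2, proved in the
tree); and its law in the disc is `μ` itself by the invariance hypothesis.
[cite: LawlerSchrammWerner2003Restriction, p. 5 result 2] -/
theorem discRestrictionIsSLE_proof :
    Summit.CriticalPhenomena.SAWScalingLimit.Theses.SAWPoincareChain.DiscRestrictionIsSLE := by
  intro μ hμP hμ hInv hRes hμs
  haveI := hμP
  -- transport data and the inverse homeomorphisms
  choose g G hGg h0 h1 hG0 hG1 hinj hmaps using exists_transportData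
  choose Θ hΘc hΘm hΘG hGΘ hΘsymm hΘD using
    fun D : DobrushinDomain ↦ exists_inverse (hGg D) (hinj D)
  have hb : ∀ (D : DobrushinDomain) (i : Fin 2),
      (g D).HasBoundaryValue ((DobrushinDomain.unitDisc).pt i) (D.pt i) := by
    intro D i
    fin_cases i
    exacts [h0 D, h1 D]
  have hG : ∀ (D : DobrushinDomain) (i : Fin 2),
      G D ((DobrushinDomain.unitDisc).pt i) = D.pt i := by
    intro D i
    fin_cases i
    exacts [hG0 D, hG1 D]
  have hμr : ∀ᵐ γ ∂μ, γ.range ⊆ closure (DobrushinDomain.unitDisc).carrier :=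
    hμ.mono fun γ h ↦ h.2.2
  -- the four properties of the transported family
  have hPc : ChordalFamily.IsChordal (fun D ↦ μ.map (CurveClass.map (G D))) :=
    isChordal_transport hμ hG0 hG1 fun D ↦ mapsTo_closure (hGg D)
  have hPs : ChordalFamily.IsCarriedBySimpleCurves (fun D ↦ μ.map (CurveClass.map (G D))) :=
    isCarriedBySimpleCurves_transport hμ hμs hG0 hG1 hinj hmaps
  have hPcov : ChordalFamily.IsConformallyCovariant (fun D ↦ μ.map (CurveClass.map (G D))) :=
    isConformallyCovariant_transport hμr hInv hGg hb hG hΘc hΘG hΘsymm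
  have hPres : ChordalFamily.IsHullRestriction (fun D ↦ μ.map (CurveClass.map (G D))) :=
    isHullRestriction_transport hμr hRes hGg hb hG hΘc hΘG hGΘ hΘsymm hΘD
  -- the law in the disc is `μ`
  have hPD : μ.map (CurveClass.map (G DobrushinDomain.unitDisc)) = μ :=
    hInv (g DobrushinDomain.unitDisc) (G DobrushinDomain.unitDisc) (h0 DobrushinDomain.unitDisc)
      (h1 DobrushinDomain.unitDisc) (hGg DobrushinDomain.unitDisc)
  have := isSLELaw_of_isHullRestriction hPc hPcov hPres hPs DobrushinDomain.unitDisc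
  rwa [hPD] at this

end Summit.CriticalPhenomena.SAWScalingLimit.Theorems

end
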